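/-
Origin: expansion seat `planner-pub-hodgecm-pv01-0`, handover 2026-08-18T04:15:52Z (`HOME/pub-hodgecm-pv01/lean/Pv01/GaloisB3Abstract.lean`, md5 d6222808, 244 lines);
landed by the gen-5 packager in gate run 21 as `HodgeCM/PerL34/GaloisB3Abstract.lean` (import ^import Pv01\.→import HodgeCM.PerL34. ×1).
-/
/-
Origin: HOME/pub-hodgecm-pv01/lean/Pv01/GaloisB3Abstract.lean (module `Pv01.GaloisB3Abstract`; the packager renames to
`HodgeCM.PerL34.GaloisB3Abstract`) — session planner-pub-hodgecm-pv01-0 (unit pub-hodgecm-pv01, DAG-NODE PROVER #01).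
DAG node N03 (PerL v5 Lemma 2.1(b), ll. 153–156) / §1.2 ll. 47–50.  ADDITIVE companion of `Pv01.GaloisB3`:
removes the coordinate choice `Hom(K,ℂ) ≃ Fin 6` from the dictionary.  Pure Mathlib + `Pv01.GaloisB3`.
-/
import Mathlib
import Summits.HodgeConjecture.HodgeCM.PerL34.GaloisB3

set_option autoImplicit false

/-!
# `H' = H` for an ABSTRACT faithful action (coordinate-free form of `GaloisB3`)

`GaloisB3.rightStab_tilde_eq_of_card` is stated for subgroups of `𝔖₆ = Perm (Fin 6)` commuting with the fixed
involution `cc = (0 3)(1 4)(2 5)`.  Here the same statements are derived for ANY group `G` acting faithfully on ANY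
six-element type `X` with a central involution `c ∈ G` acting without fixed points — which is literally the shape of
the Galois data of PerL §1.2: `G = Gal(L/ℚ)` acting on `X = Hom(K, ℂ) = Hom_ℚ(K, L)` by post-composition (faithful
because `L` is the normal closure of `K`; `|X| = [K:ℚ] = 6`), `c` = complex conjugation (central, PerL l. 47; `c ∘ φ =
φ ∘ c_K ≠ φ` because `K` is a CM field, so `c` moves every embedding), `x₀ = φ₁`, `H = Stab_G(φ₁) = Gal(L/K)`, a CM
type `Φ_t ∋ φ₁` = a subset `Φ ⊆ X` with `x ∈ Φ ↔ c • x ∉ Φ`, and `\widetilde Φ_t = {g : g • φ₁ ∈ Φ}`.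

Main results (kernel):
* `exists_equiv_cc` — NORMAL FORM: a fixed-point-free involution of a `6`-element type is conjugate to `cc` by a
  bijection `X ≃ Fin 6` sending a chosen point `x₀` to `0`.
* `rightStab_pullback_eq_stabilizer` — **PerL L2.1(b) "H' = H"**: for `|G| ∈ {24, 48}`,
  `RfwfReflex.rightStab {g | g • x₀ ∈ Φ} = MulAction.stabilizer G x₀` (the A11 port's `H'`, hence its `K' = L^{H'} = K`).
* `no_index_two_above_stabilizer` — **"K contains no (imaginary) quadratic subfield"**: no subgroup of index `2`
  of `G` contains `Stab_G(x₀)`.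
* `card_stabilizer` — **"|H| = 4 resp. 8"** when the action is transitive (orbit–stabiliser).

Residual dictionary after this file: only the four textbook identifications listed above (Galois group acts
faithfully on the embeddings of a subfield generating the normal closure; `|Gal(L/ℚ)| = [L:ℚ]`; `Gal(L/K)` is the
stabiliser of the inclusion; complex conjugation of a CM Galois closure is a central involution moving every
embedding of the CM subfield `K`).  Nothing internal is cited.
-/

namespace HodgeCM
namespace PerL34
namespace GaloisB3

open Equiv

/-! ### Normal form of a fixed-point-free involution on six points -/

section NormalForm

variable {X : Type*} [Fintype X] [DecidableEq X]

/-- (Ported verbatim from the HodgeCMPerL package; no docstring in the source.) -/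
private theorem exists_not_mem_of_card_lt (S : Finset X) (hS : S.card < Fintype.card X) : ∃ x, x ∉ S := by
  by_contra h
  push Not at h
  have : Finset.univ ⊆ S := fun x _ => h x
  have := Finset.card_le_card this
  rw [Finset.card_univ] at this
  omega

/-- The coordinate vector `(x₀, x₁, x₂, σx₀, σx₁, σx₂)`. -/
def nf6 (σ : Perm X) (x₀ x₁ x₂ : X) : Fin 6 → X := ![x₀, x₁, x₂, σ x₀, σ x₁, σ x₂]

/-- NORMAL FORM.  A fixed-point-free involution `σ` of a six-element type is conjugate to `cc` by a bijection
`X ≃ Fin 6` taking a prescribed point `x₀` to `0`. -/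
theorem exists_equiv_cc (hX : Fintype.card X = 6) (σ : Perm X) (hσ2 : ∀ x, σ (σ x) = x)
    (hfix : ∀ x, σ x ≠ x) (x₀ : X) :
    ∃ e : X ≃ Fin 6, e x₀ = 0 ∧ ∀ x, e (σ x) = cc (e x) := by
  obtain ⟨x₁, hx₁⟩ := exists_not_mem_of_card_lt ({x₀, σ x₀} : Finset X)
    (lt_of_le_of_lt Finset.card_le_two (by omega))
  obtain ⟨x₂, hx₂⟩ := exists_not_mem_of_card_lt ({x₀, σ x₀, x₁, σ x₁} : Finset X)
    (lt_of_le_of_lt Finset.card_le_four (by omega))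
  simp only [Finset.mem_insert, Finset.mem_singleton, not_or] at hx₁ hx₂
  obtain ⟨h10, h10'⟩ := hx₁
  obtain ⟨h20, h20', h21, h21'⟩ := hx₂
  -- the fifteen pairwise inequalities
  have hσinj : ∀ {a b}, σ a = σ b → a = b := fun h => σ.injective h
  have n1 : σ x₁ ≠ x₀ := fun h => h10' (by rw [← h, hσ2])
  have n2 : σ x₂ ≠ x₀ := fun h => h20' (by rw [← h, hσ2])
  have n3 : σ x₂ ≠ x₁ := fun h => h21' (by rw [← h, hσ2])
  have n4 : σ x₁ ≠ σ x₀ := fun h => h10 (hσinj h)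
  have n5 : σ x₂ ≠ σ x₀ := fun h => h20 (hσinj h)
  have n6 : σ x₂ ≠ σ x₁ := fun h => h21 (hσinj h)
  have f0 := hfix x₀
  have f1 := hfix x₁
  have f2 := hfix x₂
  have ginj : Function.Injective (nf6 σ x₀ x₁ x₂) := by
    intro i j h
    fin_cases i <;> fin_cases j <;> simp [nf6] at h <;>
      first | rfl | exact absurd h (by assumption) | exact absurd h.symm (by assumption)
  have hg : ∀ i, σ (nf6 σ x₀ x₁ x₂ i) = nf6 σ x₀ x₁ x₂ (cc i) := by
    intro i
    rw [cc_apply]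
    fin_cases i <;> first | exact hσ2 _ | rfl
  set g := nf6 σ x₀ x₁ x₂ with hgdef
  have gbij : Function.Bijective g :=
    (Fintype.bijective_iff_injective_and_card g).mpr ⟨ginj, by simp [hX]⟩
  refine ⟨(Equiv.ofBijective g gbij).symm, ?_, ?_⟩
  · exact (Equiv.ofBijective g gbij).symm_apply_eq.mpr rfl
  · intro x
    obtain ⟨i, rfl⟩ := gbij.2 x
    rw [hg]
    simp [Equiv.ofBijective_symm_apply_apply]

end NormalForm

/-! ### Transport of an abstract faithful action to `Perm (Fin 6)` -/

section Transport

variable {G : Type*} [Group G] {X : Type*} [MulAction G X] (e : X ≃ Fin 6)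

/-- The permutation image of `G` in `𝔖₆`, in the coordinates `e`. -/
def toPerm6 : G →* Perm (Fin 6) := e.permCongrHom.toMonoidHom.comp (MulAction.toPermHom G X)

/-- (Ported verbatim from the HodgeCMPerL package; no docstring in the source.) -/
theorem toPerm6_apply (g : G) (i : Fin 6) : toPerm6 e g i = e (g • e.symm i) := rfl

/-- (Ported verbatim from the HodgeCMPerL package; no docstring in the source.) -/
theorem toPerm6_injective [FaithfulSMul G X] : Function.Injective (toPerm6 (G := G) e) :=
  e.permCongrHom.injective.comp MulAction.toPerm_injective

variable {e}

/-- A central `c` acting through `cc` (in the coordinates `e`) puts the image inside `W = C_{𝔖₆}(cc)`. -/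
theorem toPerm6_eq_cc {c : G} (hce : ∀ x, e (c • x) = cc (e x)) : toPerm6 e c = cc := by
  ext i
  rw [toPerm6_apply, hce, Equiv.apply_symm_apply]

/-- (Ported verbatim from the HodgeCMPerL package; no docstring in the source.) -/
theorem range_toPerm6_le_W {c : G} (hcen : ∀ g : G, c * g = g * c) (hce : ∀ x, e (c • x) = cc (e x)) :
    (toPerm6 (G := G) e).range ≤ W := by
  rintro _ ⟨g, rfl⟩
  rw [mem_W, ← toPerm6_eq_cc hce, ← map_mul, ← map_mul, hcen]

end Transport

/-! ### The abstract statements -/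

section Abstract

variable {G : Type*} [Group G] {X : Type*} [Fintype X] [DecidableEq X] [MulAction G X] [FaithfulSMul G X]

open HodgeCM.Prior.ReflexLemma.RfwfReflex in
/-- Transport of the A11 right stabiliser along a hom onto its range. -/
private theorem mem_rightStab_iff_range {G' : Type*} [Group G'] (f : G →* G')
    (Θ : Set G) (Θ' : Set f.range)
    (hΘ : ∀ g : G, (⟨f g, ⟨g, rfl⟩⟩ : f.range) ∈ Θ' ↔ g ∈ Θ) (u : G) :
    u ∈ rightStab Θ ↔ (⟨f u, ⟨u, rfl⟩⟩ : f.range) ∈ rightStab Θ' := by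
  rw [mem_rightStab, mem_rightStab]
  unfold RStab
  constructor
  · rintro h ⟨_, ⟨x, rfl⟩⟩
    have hmul : (⟨f x, ⟨x, rfl⟩⟩ : f.range) * ⟨f u, ⟨u, rfl⟩⟩ = ⟨f (x * u), ⟨x * u, rfl⟩⟩ :=
      Subtype.ext (by simp)
    rw [hmul, hΘ, hΘ]
    exact h x
  · intro h x
    have hmul : (⟨f x, ⟨x, rfl⟩⟩ : f.range) * ⟨f u, ⟨u, rfl⟩⟩ = ⟨f (x * u), ⟨x * u, rfl⟩⟩ :=
      Subtype.ext (by simp)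
    have := h ⟨f x, ⟨x, rfl⟩⟩
    rw [hmul, hΘ, hΘ] at this
    exact this

/-- **PerL Lemma 2.1(b), "H' = H", coordinate-free.**  Let `G` (of order `24` or `48`) act faithfully on a
six-element type `X`; let `c ∈ G` be central with `c² = 1` moving every point of `X`; let `Φ ⊆ X` be a CM type
(`x ∈ Φ ↔ c • x ∉ Φ`) containing `x₀`.  Then the right stabiliser (A11 `RfwfReflex.rightStab`) of the pulled-back
type `\widetilde Φ = {g : g • x₀ ∈ Φ}` is EXACTLY the stabiliser `H` of `x₀` (it always contains `H`; equality is the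
primitivity of `Φ`). -/
theorem rightStab_pullback_eq_stabilizer (hX : Fintype.card X = 6)
    (hcard : Nat.card G = 24 ∨ Nat.card G = 48) (c : G) (hcen : ∀ g : G, c * g = g * c) (hc2 : c * c = 1)
    (hfix : ∀ x : X, c • x ≠ x) (Φ : Finset X) (hΦ : ∀ x, x ∈ Φ ↔ c • x ∉ Φ) (x₀ : X) (h0 : x₀ ∈ Φ) :
    HodgeCM.Prior.ReflexLemma.RfwfReflex.rightStab {g : G | g • x₀ ∈ Φ} = MulAction.stabilizer G x₀ := by
  -- normal form for the involution `c`
  obtain ⟨e, he0, hce⟩ := exists_equiv_cc hX (MulAction.toPerm c)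
    (fun x => by simp [MulAction.toPerm_apply, smul_smul, hc2]) (fun x => hfix x) x₀
  replace hce : ∀ x, e (c • x) = cc (e x) := fun x => by simpa [MulAction.toPerm_apply] using hce x
  -- the permutation image
  set f : G →* Perm (Fin 6) := toPerm6 e with hf
  have hfinj : Function.Injective f := toPerm6_injective e
  have hW : f.range ≤ W := range_toPerm6_le_W hcen hce
  have hcc : cc ∈ f.range := ⟨c, toPerm6_eq_cc hce⟩
  have hcard' : Nat.card f.range = 24 ∨ Nat.card f.range = 48 := by
    rwa [← Nat.card_congr (MonoidHom.ofInjective hfinj).toEquiv]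
  -- the transported CM type
  set Φ6 : Finset (Fin 6) := Φ.map e.toEmbedding with hΦ6
  have hmem : ∀ x, e x ∈ Φ6 ↔ x ∈ Φ := fun x => by
    rw [hΦ6, Finset.mem_map_equiv, Equiv.symm_apply_apply]
  have hΦ6cm : IsCMType Φ6 := by
    intro a
    obtain ⟨x, rfl⟩ := e.surjective a
    rw [hmem, ← hce, hmem]
    exact hΦ x
  have h06 : (0 : Fin 6) ∈ Φ6 := by rw [← he0, hmem]; exact h0
  have key := rightStab_tilde_eq_of_card f.range hW hcc hcard' hΦ6cm h06
  -- pull back along `f`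
  have hΘ : ∀ g : G, (⟨f g, ⟨g, rfl⟩⟩ : f.range) ∈ tilde f.range Φ6 ↔ g ∈ {g : G | g • x₀ ∈ Φ} := by
    intro g
    show (f g) 0 ∈ Φ6 ↔ g • x₀ ∈ Φ
    rw [hf, toPerm6_apply, ← he0, Equiv.symm_apply_apply, hmem]
  ext u
  rw [mem_rightStab_iff_range f _ (tilde f.range Φ6) hΘ, key, mem_stabBase,
    MulAction.mem_stabilizer_iff]
  show (f u) 0 = 0 ↔ u • x₀ = x₀
  rw [hf, toPerm6_apply, ← he0, Equiv.symm_apply_apply]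
  exact e.apply_eq_iff_eq

/-- **"`K` contains no imaginary quadratic field"** ([Y1neg] L7.1(b) as used in PerL §1.2), coordinate-free: under
the same hypotheses, no subgroup `M` of index two in `G` contains the stabiliser of `x₀`
(Galois correspondence: such an `M` would be `Gal(L/E)` for a quadratic field `E ⊆ K`). -/
theorem no_index_two_above_stabilizer (hX : Fintype.card X = 6)
    (hcard : Nat.card G = 24 ∨ Nat.card G = 48) (c : G) (hcen : ∀ g : G, c * g = g * c) (hc2 : c * c = 1)
    (hfix : ∀ x : X, c • x ≠ x) (x₀ : X) (M : Subgroup G) (hM : MulAction.stabilizer G x₀ ≤ M)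
    (hidx : Nat.card M * 2 = Nat.card G) : False := by
  classical
  obtain ⟨e, he0, hce⟩ := exists_equiv_cc hX (MulAction.toPerm c)
    (fun x => by simp [MulAction.toPerm_apply, smul_smul, hc2]) (fun x => hfix x) x₀
  replace hce : ∀ x, e (c • x) = cc (e x) := fun x => by simpa [MulAction.toPerm_apply] using hce x
  set f : G →* Perm (Fin 6) := toPerm6 e with hf
  have hfinj : Function.Injective f := toPerm6_injective e
  have hW : f.range ≤ W := range_toPerm6_le_W hcen hce
  have hcc : cc ∈ f.range := ⟨c, toPerm6_eq_cc hce⟩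
  have hGcard : Nat.card f.range = Nat.card G := (Nat.card_congr (MonoidHom.ofInjective hfinj).toEquiv).symm
  have hcard' : Nat.card f.range = 24 ∨ Nat.card f.range = 48 := by rwa [hGcard]
  have hMcard : Nat.card (M.map f) = Nat.card M := Nat.card_congr (M.equivMapOfInjective f hfinj).toEquiv.symm
  refine no_index_two_over_stab f.range hW hcc hcard' (M.map f) ?_ ?_ ?_
  · exact Subgroup.map_le_range f M
  · rintro _ ⟨g, rfl⟩ hg0
    refine ⟨g, hM ?_, rfl⟩
    rw [MulAction.mem_stabilizer_iff]
    have : e (g • e.symm 0) = 0 := by simpa [hf, toPerm6_apply] using hg0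
    rw [← he0, Equiv.symm_apply_apply] at this
    exact e.injective this
  · rw [hMcard, hGcard]; exact hidx

omit [DecidableEq X] [FaithfulSMul G X] in
/-- **"|H| = 4 resp. 8"** (PerL §1.2 l. 49): for a TRANSITIVE action (as `Gal(L/ℚ)` on `Hom(K,ℂ)` is), the
stabiliser has order `|G| / 6`. -/
theorem card_stabilizer [MulAction.IsPretransitive G X] (hX : Fintype.card X = 6)
    (hcard : Nat.card G = 24 ∨ Nat.card G = 48) (x₀ : X) :
    Nat.card (MulAction.stabilizer G x₀) = 4 ∨ Nat.card (MulAction.stabilizer G x₀) = 8 := by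
  have h := (MulAction.stabilizer G x₀).card_mul_index
  rw [MulAction.index_stabilizer_of_transitive, Nat.card_eq_fintype_card (α := X), hX] at h
  omega

end Abstract

end GaloisB3
end PerL34
end HodgeCM
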